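import Mathlib
import HarnessLib
import Summits.Ventures.LatticeQCDFlow.Scoring.ReversibleKernelTauIntFloor
import Summits.Ventures.LatticeQCDFlow.Scoring.DoeblinGreenKubo

/-!
# The window bracket on a general state space: for a reversible kernel minorised by its invariant
# law, `τ_int ≤ τ_W(2m) + (1/ε − 1)·ρ(2m)` and `τ_int ≤ τ_W(2m+1) + (1/ε − 1)(1 − ε)·ρ(2m)`

HONEST FRAMING: exact (Metropolis-corrected) sampling algorithms for lattice gauge theory;
figures of merit are autocorrelation/cost numbers at stated couplings and volumes; no
continuum-physics claim.

Venture `LatticeQCDFlow` (cell pub-lqcd), topic `Scoring`; FANOUT row 8 (`s0-cpn-nemc`, GEN-11).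
NEW WORK of the cell (one shift identity and a geometric tail sum), not a published result: the
general-state-space (Mathlib `ProbabilityTheory.Kernel`) form of row 8's finite-pool
`Scoring/IMHWindowBracket.lean` (`imh_tauInt_le_window`, `imh_tauInt_le_window_odd`), composing
row 8's reversibility on observables (`Scoring/ReversibleKernelTauIntFloor.lean`:
`kop_opSymm`, with row 2's abstract two-time form `Exactness.op_two_time`) and row 8's Doeblin
envelope (`Scoring/DoeblinAutocorrelation.lean`: `abs_autocov_le_of_doeblin`).  Printed counterpart
of the SHAPE, named only: Schaefer–Sommer–Virotta's `τ_exp`-improved window estimate (the finite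
file's reading rule IMH-LAW R-I4); here the role of `τ_exp` is played by the certified Doeblin rate
`−1/log(1 − ε) ≤ 1/ε`.

## What is proved (`κ` Markov, `π` an invariant probability law, `κ` `π`-REVERSIBLE and minorised by
## `π` itself: `κ(x, B) ≥ ε π(B)`; `f` bounded measurable `π`-centred; `C(t) = autocov κ π f t`,
## `ρ(t) = C(t)/C(0)`)

* `autocov_two_mul_add_of_isReversible` — the SHIFT IDENTITY `C(2m + s) = C_{g}(s)` for the bounded
  measurable centred observable `g = (kop κ)^[m] f` (detailed balance moves `m` steps across);
  `autocov_two_mul_eq_sq` (`C(2m) = ∫ g² dπ ≥ 0`).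
* **`abs_autocov_two_mul_add_le_of_doeblin`** — `|C(2m + s)| ≤ (1 − ε)ˢ · C(2m)`: the envelope
  restarted at every even lag (constant one in front of `C(2m)`, not of `C(0)`).
* `summable_acf_of_doeblin`, **`tauInt_le_window_even_of_doeblin`** —
  `τ_int ≤ τ_W(2m) + (1/ε − 1) · ρ(2m)` for every `m`, and **`tauInt_le_window_odd_of_doeblin`** —
  `τ_int ≤ τ_W(2m+1) + (1/ε − 1)(1 − ε) · ρ(2m)`: an UPPER bound on the figure of merit from a finite
  window of the true autocorrelation function plus the certified rate, for EVERY bounded observable.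

Reading (markdown): together with the lower sides (`Scoring/ReversibleKernelTauIntFloor.lean`: odd
windows for every reversible kernel; `Scoring/IndepMHKernelPositive.lean`: all windows for the flow
sampler) this brackets `τ_int` between two finite-window expressions whose gap is
`(1/ε − 1)·ρ(2m) → 0`; for the exact flow sampler with flow-equation defect `δ`, `1/ε − 1 = e^{2δ} − 1`.
NOT CLAIMED: anything about estimated (noisy) autocorrelations or the automatic-window rule; any
number of ours; non-reversible kernels (the envelope alone gives `|τ_int − τ_W(N)| ≤ (1−ε)^{N+1}/ε`
with `C(0)` in place of `C(2m)`, weaker and not stated here).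
-/

noncomputable section

namespace Summit.Ventures.LatticeQCDFlow.Scoring

open MeasureTheory ProbabilityTheory Filter Finset Summit.Ventures.LatticeQCDFlow.Exactness
open scoped ENNReal Topology

variable {Ω : Type*} [MeasurableSpace Ω]

section Bracket

variable {κ : Kernel Ω Ω} [IsMarkovKernel κ] {π : Measure Ω} [IsProbabilityMeasure π] {ε : ℝ≥0∞}

/-- **Shift identity** (detailed balance): `C_f(2m + s) = C_g(s)` with `g = (kop κ)^[m] f`. -/
theorem autocov_two_mul_add_of_isReversible (hrev : Kernel.IsReversible κ π) {f : Ω → ℝ}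
    (hf : Measurable f) {C : ℝ} (hC : ∀ x, |f x| ≤ C) (m s : ℕ) :
    autocov κ π f (2 * m + s) = autocov κ π ((kop κ)^[m] f) s := by
  have two := op_two_time (μ := π) (w := fun _ : Ω => (1 : ℝ)) (K := kop κ) kop_opBdd
    (kop_opSymm hrev) hf hC m (m + s)
  rw [integral_mul_iterate_kop_mul_one, show m + (m + s) = 2 * m + s by ring] at two
  rw [← two]
  unfold autocov
  refine integral_congr_ae (ae_of_all _ fun x => ?_)
  show (kop κ)^[m] f x * (kop κ)^[m + s] f x * 1 = (kop κ)^[m] f x * (kop κ)^[s] ((kop κ)^[m] f) x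
  rw [mul_one, Nat.add_comm m s, Function.iterate_add_apply]

/-- `C_f(2m) = ∫ ((kop κ)^[m] f)² dπ`. -/
theorem autocov_two_mul_eq_sq (hrev : Kernel.IsReversible κ π) {f : Ω → ℝ} (hf : Measurable f)
    {C : ℝ} (hC : ∀ x, |f x| ≤ C) (m : ℕ) :
    autocov κ π f (2 * m) = ∫ x, ((kop κ)^[m] f x) ^ 2 ∂π := by
  rw [← autocov_zero, ← autocov_two_mul_add_of_isReversible hrev hf hC m 0, add_zero]

/-- **The envelope restarted at an even lag**: `|C(2m + s)| ≤ (1 − ε)ˢ · C(2m)` for a reversible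
kernel minorised by its invariant law and a bounded measurable centred observable. -/
theorem abs_autocov_two_mul_add_le_of_doeblin (hrev : Kernel.IsReversible κ π)
    (hmin : ∀ x {B : Set Ω}, MeasurableSet B → ε * π B ≤ κ x B) {f : Ω → ℝ} (hf : Measurable f)
    {C : ℝ} (hC : ∀ x, |f x| ≤ C) (hf0 : ∫ x, f x ∂π = 0) (m s : ℕ) :
    |autocov κ π f (2 * m + s)| ≤ (1 - ε.toReal) ^ s * autocov κ π f (2 * m) := by
  have hinv : Kernel.Invariant κ π := hrev.invariant
  obtain ⟨hgm, hgb⟩ := iterate_kop_bounded_measurable κ hf hC m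
  have hg0 : ∫ x, (kop κ)^[m] f x ∂π = 0 := by rw [integral_iterate_kop κ hinv hf hC m, hf0]
  rw [autocov_two_mul_add_of_isReversible hrev hf hC m s, autocov_two_mul_eq_sq hrev hf hC m]
  exact abs_autocov_le_of_doeblin hinv hmin hgm hgb hg0 s

/-- Normalised: `|ρ(2m + s)| ≤ (1 − ε)ˢ · ρ(2m)` (with Lean's `x/0 = 0` when `C(0) = 0`). -/
theorem abs_acf_two_mul_add_le_of_doeblin (hrev : Kernel.IsReversible κ π)
    (hmin : ∀ x {B : Set Ω}, MeasurableSet B → ε * π B ≤ κ x B) {f : Ω → ℝ} (hf : Measurable f)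
    {C : ℝ} (hC : ∀ x, |f x| ≤ C) (hf0 : ∫ x, f x ∂π = 0) (m s : ℕ) :
    |autocov κ π f (2 * m + s) / autocov κ π f 0|
      ≤ (1 - ε.toReal) ^ s * (autocov κ π f (2 * m) / autocov κ π f 0) := by
  have h := abs_autocov_two_mul_add_le_of_doeblin hrev hmin hf hC hf0 m s
  have h0 : 0 ≤ autocov κ π f 0 := by
    rw [autocov_zero]; exact integral_nonneg fun x => sq_nonneg _
  rw [abs_div, abs_of_nonneg h0, mul_div_assoc']
  exact div_le_div_of_nonneg_right h h0

/-- The lag series of a bounded measurable centred observable is summable under Doeblin (`ε > 0`). -/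
theorem summable_acf_of_doeblin (hinv : Kernel.Invariant κ π)
    (hmin : ∀ x {B : Set Ω}, MeasurableSet B → ε * π B ≤ κ x B) (hε0 : 0 < ε) {f : Ω → ℝ}
    (hf : Measurable f) {C : ℝ} (hC : ∀ x, |f x| ≤ C) (hf0 : ∫ x, f x ∂π = 0) :
    Summable fun t => autocov κ π f (t + 1) / autocov κ π f 0 :=
  summable_succ_of_summable_moment (ρ := fun t => autocov κ π f t / autocov κ π f 0)
    (summable_moment_acf_of_doeblin hinv hmin hε0 hf hC hf0)

/-- The geometric tail constant: `Σ_{s ≥ 0} (1 − ε)^{s+1} = 1/ε − 1` (`0 < ε ≤ 1`). -/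
theorem hasSum_pow_succ_of_doeblin (hmin : ∀ x {B : Set Ω}, MeasurableSet B → ε * π B ≤ κ x B)
    (hε0 : 0 < ε) :
    HasSum (fun s : ℕ => (1 - ε.toReal) ^ (s + 1)) (1 / ε.toReal - 1) := by
  have hε1 := eps_le_one_of_doeblin hmin
  have hεr0 : 0 < ε.toReal :=
    ENNReal.toReal_pos hε0.ne' (ne_top_of_le_ne_top ENNReal.one_ne_top hε1)
  have hl0 : 0 ≤ 1 - ε.toReal := one_sub_toReal_nonneg_of_doeblin hmin
  have habs : |1 - ε.toReal| < 1 := by rw [abs_of_nonneg hl0]; linarith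
  have h := hasSum_geometric_succ habs
  have e : (1 - ε.toReal) / (1 - (1 - ε.toReal)) = 1 / ε.toReal - 1 := by
    rw [sub_sub_cancel, sub_div, div_self hεr0.ne']
  rwa [e] at h

/-- **THE WINDOW BRACKET, EVEN FORM**: `τ_int ≤ τ_W(2m) + (1/ε − 1) · ρ(2m)` for every `m`, every
bounded measurable `π`-centred observable of a `π`-reversible Markov kernel with `κ(x,·) ≥ ε π`,
`ε > 0` — the tail beyond the window decays from `ρ(2m)` at the certified rate. -/
theorem tauInt_le_window_even_of_doeblin (hrev : Kernel.IsReversible κ π)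
    (hmin : ∀ x {B : Set Ω}, MeasurableSet B → ε * π B ≤ κ x B) (hε0 : 0 < ε) {f : Ω → ℝ}
    (hf : Measurable f) {C : ℝ} (hC : ∀ x, |f x| ≤ C) (hf0 : ∫ x, f x ∂π = 0) (m : ℕ) :
    tauInt (fun t => autocov κ π f t / autocov κ π f 0)
      ≤ tauIntWindow (fun t => autocov κ π f t / autocov κ π f 0) (2 * m)
        + (1 / ε.toReal - 1) * (autocov κ π f (2 * m) / autocov κ π f 0) := by
  set ρ : ℕ → ℝ := fun t => autocov κ π f t / autocov κ π f 0 with hρ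
  have hs : Summable fun t => ρ (t + 1) := summable_acf_of_doeblin hrev.invariant hmin hε0 hf hC hf0
  have hsplit := hs.sum_add_tsum_nat_add (2 * m)
  -- the tail beyond the window
  have htail_s : Summable fun s : ℕ => ρ (s + 2 * m + 1) := (summable_nat_add_iff (2 * m)).2 hs
  have hgeo := hasSum_pow_succ_of_doeblin hmin hε0
  have hbound : ∀ s : ℕ, ρ (s + 2 * m + 1) ≤ (1 - ε.toReal) ^ (s + 1) * ρ (2 * m) := fun s => by
    have h := abs_acf_two_mul_add_le_of_doeblin hrev hmin hf hC hf0 m (s + 1)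
    rw [show 2 * m + (s + 1) = s + 2 * m + 1 by ring] at h
    exact (le_abs_self _).trans h
  have htail : ∑' s : ℕ, ρ (s + 2 * m + 1) ≤ (1 / ε.toReal - 1) * ρ (2 * m) := by
    calc ∑' s : ℕ, ρ (s + 2 * m + 1) ≤ ∑' s : ℕ, (1 - ε.toReal) ^ (s + 1) * ρ (2 * m) :=
          htail_s.tsum_le_tsum hbound (hgeo.summable.mul_right _)
      _ = (1 / ε.toReal - 1) * ρ (2 * m) := by rw [tsum_mul_right, hgeo.tsum_eq]
  unfold tauInt tauIntWindow
  have e : ∑' t, ρ (t + 1) = ∑ t ∈ Finset.range (2 * m), ρ (t + 1) + ∑' s, ρ (s + 2 * m + 1) :=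
    hsplit.symm
  simp only [hρ] at e htail ⊢
  linarith

/-- **THE WINDOW BRACKET, ODD FORM**: `τ_int ≤ τ_W(2m+1) + (1/ε − 1)(1 − ε) · ρ(2m)`. -/
theorem tauInt_le_window_odd_of_doeblin (hrev : Kernel.IsReversible κ π)
    (hmin : ∀ x {B : Set Ω}, MeasurableSet B → ε * π B ≤ κ x B) (hε0 : 0 < ε) {f : Ω → ℝ}
    (hf : Measurable f) {C : ℝ} (hC : ∀ x, |f x| ≤ C) (hf0 : ∫ x, f x ∂π = 0) (m : ℕ) :
    tauInt (fun t => autocov κ π f t / autocov κ π f 0)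
      ≤ tauIntWindow (fun t => autocov κ π f t / autocov κ π f 0) (2 * m + 1)
        + (1 / ε.toReal - 1) * (1 - ε.toReal) * (autocov κ π f (2 * m) / autocov κ π f 0) := by
  set ρ : ℕ → ℝ := fun t => autocov κ π f t / autocov κ π f 0 with hρ
  have hs : Summable fun t => ρ (t + 1) := summable_acf_of_doeblin hrev.invariant hmin hε0 hf hC hf0
  have hsplit := hs.sum_add_tsum_nat_add (2 * m + 1)
  have htail_s : Summable fun s : ℕ => ρ (s + (2 * m + 1) + 1) :=
    (summable_nat_add_iff (2 * m + 1)).2 hs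
  have hgeo := (hasSum_pow_succ_of_doeblin hmin hε0).mul_right (1 - ε.toReal)
  have hbound : ∀ s : ℕ, ρ (s + (2 * m + 1) + 1)
      ≤ (1 - ε.toReal) ^ (s + 1) * (1 - ε.toReal) * ρ (2 * m) := fun s => by
    have h := abs_acf_two_mul_add_le_of_doeblin hrev hmin hf hC hf0 m (s + 2)
    rw [show 2 * m + (s + 2) = s + (2 * m + 1) + 1 by ring, pow_succ] at h
    exact (le_abs_self _).trans h
  have htail : ∑' s : ℕ, ρ (s + (2 * m + 1) + 1)
      ≤ (1 / ε.toReal - 1) * (1 - ε.toReal) * ρ (2 * m) := by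
    calc ∑' s : ℕ, ρ (s + (2 * m + 1) + 1)
          ≤ ∑' s : ℕ, (1 - ε.toReal) ^ (s + 1) * (1 - ε.toReal) * ρ (2 * m) :=
          htail_s.tsum_le_tsum hbound (hgeo.summable.mul_right _)
      _ = (1 / ε.toReal - 1) * (1 - ε.toReal) * ρ (2 * m) := by rw [tsum_mul_right, hgeo.tsum_eq]
  unfold tauInt tauIntWindow
  have e : ∑' t, ρ (t + 1)
      = ∑ t ∈ Finset.range (2 * m + 1), ρ (t + 1) + ∑' s, ρ (s + (2 * m + 1) + 1) := hsplit.symm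
  simp only [hρ] at e htail ⊢
  linarith

end Bracket

end Summit.Ventures.LatticeQCDFlow.Scoring

end
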